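import Literature.AlgebraicGeometry.Resolution.KnafKuhlmann2009Holds
import HarnessLib

/-!
# Cossart–Piltant I, Problem 9.1 (pushing down local uniformization), typed — and why it is all that is missing for local uniformization in every dimension

Topic: `Literature/AlgebraicGeometry/CossartPiltant2008to2019` — typed skeleton of PUBLISHED
work (V. Cossart, O. Piltant, *Resolution of singularities of threefolds in positive
characteristic I*, J. Algebra 320 (2008) 1051–1082, §9), written for the dimension-`4`
obstruction census of the cell `pub-hironaka` (unit `b2b-hironaka-cp4`, `OBSTRUCTIONS-DIM4.md`,
input O7). Verbatim, ms p. 26: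

> **Problem 9.1.** (Pushing down local uniformization) Let `L/K` be an extension of function
> fields of transcendence degree three over `k` and let `W/k` be a `k`-valuation ring of rank
> one such that `QF(W) = L` having a local uniformization. Has `W ∩ K/k` a local
> uniformization?
>
> An affirmative answer to this problem would allow us to deduce local uniformization from
> de Jong's theorem [29] or from its weaker valuative version [34]. However, we do not know how
> to deal with the case when `W/W ∩ K` is wildly ramified. Since we are interested here in
> applications to the local uniformization problem, this wildly ramified case can be avoided
> via Abhyankar's construction performed in the proof of theorem 7.2. In proposition 9.5 below
> we answer in the affirmative the special case of problem 9.1 when `W/W ∩ K` is tamely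
> ramified.

([34] = Knaf–Kuhlmann 2009; Prop. 9.5: `L/K` Galois, `κ(W)/k` algebraic, `K ⊆ K' ⊆ K^r` the
ramification field: a local uniformization of `W ∩ K'` pushes down to `W ∩ K`.)
[CossartPiltant2008]

## Content

* `PushDown k` — the push-down property over the ground field `k`, for ALL finitely generated
  `K/k`, ALL finite extensions `L/K` and ALL valuation rings of `L` (Problem 9.1 drops to this by
  forgetting "transcendence degree three" and "rank one": more instances, so `PushDown k` is a
  STRONGER hypothesis than an affirmative answer to Problem 9.1 as printed; see
  `PushDown.of_localUniformizationInChar` for why nothing weaker than local uniformization itself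
  implies it). `PushDownPurelyInseparable k` — the same for finite purely inseparable `L/K`
  only (the extreme wild case).
* PROVED: `PushDown.isLocallyUniformizable_of_knafKuhlmann2009` — "An affirmative answer … would
  allow us to deduce local uniformization from … [34]": Knaf–Kuhlmann's theorem (the tree's named
  fact `KnafKuhlmann2009`, every place is uniformizable in a finite extension of the function
  field) and push-down give local uniformization of every valuation of every finitely generated
  `K/k`, in every dimension; `PushDown.isLocallyUniformizable` — the same UNCONDITIONALLY, the
  named fact being discharged in the tree (`KnafKuhlmann2009_holds`);
  `localUniformizationInChar_iff_pushDown` — for every `p`, `LocalUniformizationInChar p` (the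
  tree's local uniformization conjunct, open for prime `p` in transcendence degree `≥ 4`) is
  EQUIVALENT to push-down over every field of characteristic `p`;
  `PushDownPurelyInseparable.isLocallyUniformizable_of_temkin2013` — with Temkin's inseparable
  local uniformization (named fact `Temkin2013`) push-down through finite PURELY INSEPARABLE
  extensions already suffices.
* For the census (O7): kernel-checked, "local uniformization in dimension `≥ 4` and
  characteristic `p`" and "push-down of local uniformization through finite (equivalently:
  finite purely inseparable, modulo `Temkin2013`) extensions of function fields of
  characteristic `p`" are the same open problem.

## What is deliberately NOT here

The tame case Prop. 9.5 (ramification groups of valuations are in Mathlib, but its proof is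
Abhyankar's going-down machinery, §§6–9 of the paper); de Jong's alterations (tree
`DeJong1996`, an alteration is not a finite extension of ONE function field inside a valued
tower in the form needed here — the valuative version [34] is the one used); any claim about
Problem 9.1 itself beyond the displayed equivalence.
-/

noncomputable section

namespace Literature.AlgebraicGeometry.CossartPiltant2008to2019

open Literature.AlgebraicGeometry.Resolution

universe u

/-- **Push-down of local uniformization over `k`** (Cossart–Piltant I, Problem 9.1 "Pushing
down local uniformization", with "transcendence degree three" and "rank one" dropped): for
every finitely generated field extension `K/k`, every finite extension `L/K` and every valuation
ring `O'` of `L` that is locally uniformizable over `k` (`IsLocallyUniformizable`: some finitely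
generated `k`-subalgebra of `O'` with fraction field `L` is regular at the centre), the
valuation ring `O' ∩ K` of `K` is locally uniformizable over `k`. A predicate in `k`, asserted
nowhere: the printed problem is open ("we do not know how to deal with the case when
`W/W ∩ K` is wildly ramified"), its tame Galois case being Prop. 9.5.
[cite: CossartPiltant2008, Problem 9.1 (with Prop. 9.5 for the tame case)] -/
def PushDown (k : Type u) [Field k] : Prop :=
  ∀ (K : Type u) [Field K] [Algebra k K], (⊤ : IntermediateField k K).FG →
    ∀ (L : Type u) [Field L] [Algebra K L] [Algebra k L] [IsScalarTower k K L],
      FiniteDimensional K L →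
      ∀ O' : ValuationSubring L, IsLocallyUniformizable k L O' →
        IsLocallyUniformizable k K (O'.comap (algebraMap K L))

/-- **Push-down through finite purely inseparable extensions** — `PushDown k` restricted to
`L/K` finite purely inseparable (then `O'` is the unique valuation ring of `L` over `O' ∩ K` and
`O'/O' ∩ K` is immediate or wildly ramified: the case Problem 9.1 leaves open).
[cite: CossartPiltant2008, Problem 9.1 (purely inseparable sub-case)] -/
def PushDownPurelyInseparable (k : Type u) [Field k] : Prop :=
  ∀ (K : Type u) [Field K] [Algebra k K], (⊤ : IntermediateField k K).FG →
    ∀ (L : Type u) [Field L] [Algebra K L] [Algebra k L] [IsScalarTower k K L],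
      FiniteDimensional K L → IsPurelyInseparable K L →
      ∀ O' : ValuationSubring L, IsLocallyUniformizable k L O' →
        IsLocallyUniformizable k K (O'.comap (algebraMap K L))

/-- Push-down through all finite extensions gives push-down through purely inseparable ones.
[folklore] -/
theorem PushDown.purelyInseparable {k : Type u} [Field k] (h : PushDown k) :
    PushDownPurelyInseparable k :=
  fun K _ _ hK L _ _ _ _ hfin _ O' hO' => h K hK L hfin O' hO'

/-! ## Push-down is all that is missing (proved) -/

/-- **"An affirmative answer to this problem would allow us to deduce local uniformization from
… its weaker valuative version [34]"** (Cossart–Piltant I, after Problem 9.1; [34] =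
Knaf–Kuhlmann 2009): Knaf–Kuhlmann's theorem in the tree's weak form `KnafKuhlmann2009` (every
valuation ring `O ⊇ k` of a finitely generated `K/k` has, in some finite extension `L/K`, an
extension `O'` locally uniformizable over `k`) and push-down over `k` give local uniformization
of every valuation of every finitely generated extension of `k` — in every transcendence
degree. [cite: CossartPiltant2008, Problem 9.1 (the sentence following it)] -/
theorem PushDown.isLocallyUniformizable_of_knafKuhlmann2009 (hKK : KnafKuhlmann2009.{u})
    {k : Type u} [Field k] (hP : PushDown k) (K : Type u) [Field K] [Algebra k K]
    (hK : (⊤ : IntermediateField k K).FG) (O : ValuationSubring K)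
    (hO : ∀ c : k, algebraMap k K c ∈ O) : IsLocallyUniformizable k K O := by
  obtain ⟨L, iF, iA, iA', iT, hfin, O', hO', hLU⟩ := hKK k K hK O hO
  letI : Field L := iF
  letI : Algebra K L := iA
  letI : Algebra k L := iA'
  haveI : IsScalarTower k K L := iT
  have h := hP K hK L hfin O' hLU
  rwa [hO'] at h

/-- **Unconditionally**: the named fact `KnafKuhlmann2009` is discharged in the tree
(`KnafKuhlmann2009_holds`), so push-down over `k` ALONE gives local uniformization of every
valuation ring `O ⊇ k` of every finitely generated `K/k`.
[cite: CossartPiltant2008, Problem 9.1 (the sentence following it)] -/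
theorem PushDown.isLocallyUniformizable {k : Type u} [Field k] (hP : PushDown k) (K : Type u)
    [Field K] [Algebra k K] (hK : (⊤ : IntermediateField k K).FG) (O : ValuationSubring K)
    (hO : ∀ c : k, algebraMap k K c ∈ O) : IsLocallyUniformizable k K O :=
  hP.isLocallyUniformizable_of_knafKuhlmann2009 KnafKuhlmann2009_holds K hK O hO

/-- Push-down over every field of characteristic `p` gives the tree's local uniformization
conjunct `LocalUniformizationInChar p` (every valuation of every finitely generated extension of
every field of characteristic `p`; open for prime `p` in transcendence degree `≥ 4`).
[cite: CossartPiltant2008, Problem 9.1 (the sentence following it)] -/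
theorem localUniformizationInChar_of_pushDown {p : ℕ}
    (hP : ∀ (k : Type u) [Field k] [CharP k p], PushDown k) : LocalUniformizationInChar.{u} p :=
  fun k K _ _ _ _ hK O hO => (hP k).isLocallyUniformizable K hK O hO

/-- Conversely local uniformization in characteristic `p` gives push-down over every field of
characteristic `p` outright (its conclusion holds for every valuation ring containing `k`; and
`O' ∩ K ⊇ k` because a uniformizing `k`-subalgebra of `O'` contains `k`). So `PushDown` is not
implied by anything short of local uniformization: it is a reformulation of the problem, not a
weaker waypoint. [folklore] -/
theorem PushDown.of_localUniformizationInChar {p : ℕ} (h : LocalUniformizationInChar.{u} p)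
    (k : Type u) [Field k] [CharP k p] : PushDown k := by
  intro K _ _ hK L _ _ _ _ _ O' hO'
  refine h k K hK (O'.comap (algebraMap K L)) fun c => ?_
  obtain ⟨A, hA, -, -, -⟩ := hO'
  change algebraMap K L (algebraMap k K c) ∈ O'
  rw [← IsScalarTower.algebraMap_apply]
  exact hA (A.algebraMap_mem c)

/-- **Local uniformization in characteristic `p` ⟺ push-down over every field of
characteristic `p`** (kernel-checked over the discharged `KnafKuhlmann2009`): Cossart–Piltant's
Problem 9.1, in the all-ranks / all-dimensions form `PushDown`, is EQUIVALENT to the local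
uniformization problem — for the dimension-`4` census: what separates the known altered local
uniformization (Knaf–Kuhlmann, Temkin, de Jong) from `LU₄` is exactly push-down through finite
extensions. [cite: CossartPiltant2008, Problem 9.1] [cite: KnafKuhlmann2009, Thm. 1.2] -/
theorem localUniformizationInChar_iff_pushDown (p : ℕ) :
    LocalUniformizationInChar.{u} p ↔ ∀ (k : Type u) [Field k] [CharP k p], PushDown k :=
  ⟨fun h k _ _ => PushDown.of_localUniformizationInChar h k,
    fun h => localUniformizationInChar_of_pushDown h⟩

/-- **The purely inseparable case suffices, modulo Temkin**: Temkin's inseparable local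
uniformization (the tree's named fact `Temkin2013`: the finite extension `L/K` of Knaf–Kuhlmann
can be taken purely inseparable) and push-down through finite purely inseparable extensions
give local uniformization of every valuation ring `O ⊇ k` of every finitely generated `K/k`.
[cite: Temkin2013, Thm. 1.3.2] [cite: CossartPiltant2008, Problem 9.1] -/
theorem PushDownPurelyInseparable.isLocallyUniformizable_of_temkin2013 (hT : Temkin2013.{u})
    {k : Type u} [Field k] (hP : PushDownPurelyInseparable k) (K : Type u) [Field K]
    [Algebra k K] (hK : (⊤ : IntermediateField k K).FG) (O : ValuationSubring K)
    (hO : ∀ c : k, algebraMap k K c ∈ O) : IsLocallyUniformizable k K O := by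
  obtain ⟨L, iF, iA, iA', iT, hfin, hpi, O', hO', hLU⟩ := hT k K hK O hO
  letI : Field L := iF
  letI : Algebra K L := iA
  letI : Algebra k L := iA'
  haveI : IsScalarTower k K L := iT
  have h := hP K hK L hfin hpi O' hLU
  rwa [hO'] at h

/-- Hence, modulo `Temkin2013`, push-down through finite purely inseparable extensions over
every field of characteristic `p` gives `LocalUniformizationInChar p`.
[cite: Temkin2013, Thm. 1.3.2] [cite: CossartPiltant2008, Problem 9.1] -/
theorem localUniformizationInChar_of_temkin2013_of_pushDownPurelyInseparable {p : ℕ}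
    (hT : Temkin2013.{u})
    (hP : ∀ (k : Type u) [Field k] [CharP k p], PushDownPurelyInseparable k) :
    LocalUniformizationInChar.{u} p :=
  fun k K _ _ _ _ hK O hO => (hP k).isLocallyUniformizable_of_temkin2013 hT K hK O hO

end Literature.AlgebraicGeometry.CossartPiltant2008to2019

end
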